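import Summits.ValiantsHypothesis.ValiantsHypothesis.Theorems.LacunarySymmetroidMatrixDescartesCensusDoorA34StrataSubStrata
import Summits.ValiantsHypothesis.ValiantsHypothesis.Theorems.LacunarySymmetroidMatrixDescartesCensusDoorA34NullNullLift

/-!
# `MatrixDescartes` census — DOOR A at `(3,4)`: the SUB-STRATUM LIFT (the monomial-count sub-strata are NOT where the strata line bottoms out)

HONEST FRAMING.  Object-search cell `pub-symmetroid`, engine seat `val-sym-eng-2` (g2); helper file beside the registered strata line
`Cruxes/DoorA34/Lines/strata.lean` on stmt-ValiantsHypothesis-19980 (`DoorA34 = PosRootLawAt 3 4 18`: OPEN, typed, never asserted here).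
The line's ceilings `stub_nullTopCeiling` (`det S₃ = 0 ⇒ ≤ 17`) and `stub_nullNullCeiling` (`det S₀ = det S₃ = 0 ⇒ ≤ 16`) were
split by p575885 / p576969 into a GENERIC SHEET (`tr(adj S₃·S₂) ≠ 0`, resp. `tr(adj S₀·S₁) ≠ 0`) and a codimension-one
SUB-STRATUM (`tr(adj S₃·S₂) = 0`, resp. `tr(adj S₀·S₁) = 0`) on which one further monomial dies, so that Descartes alone gives
`≤ 17` (resp. `≤ 16`) there — the bound the stubs ask for.  This file proves, ONCE FOR ALL SUPPORTS and in the chain currency of the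
tree's lift lemmas (`…CensusAltChainLift`, `…CensusDoorA34NullEndLift`, `…NullTopLift`, `…NullNullLift`), that the sub-strata
nevertheless carry the door's difficulty ONE STEP LOWER:

* `det_pencil_perturb_rankOne_letter` — rank-one perturbation of an ARBITRARY letter `S l₀ ↦ S l₀ + η·kkᵀ` changes the pencil
  determinant by `η · X^{d l₀} · kᵀ adj(F) k` (the tree's `det_pencil_perturb_rankOne` is the case `l₀ = 0`);
* `coeff_det_pencil_eq_zero_of_nullBottom_subStratum` — on the bottom sub-stratum (`det S₀ = 0`, `tr(adj S₀·S₁) = 0`,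
  `d 0 < d 1 < d l`) every coefficient of order `≤ 2 d₀ + d₁` vanishes (block anatomy `det_pencil_nullTop_eq_blocks` read at the bottom);
* `exists_altChain_of_nullBottom_subStratum` — **SUB-STRATUM LIFT (bottom, chain currency)**: there, if `kᵀ adj(S₀) k ≠ 0` and the
  determinant carries an alternation chain of `N + 1` positive points, then `S₁ ↦ S₁ + η·kkᵀ` (small `η` of the right sign; `S₀`
  untouched, so the object moves onto the GENERIC null-bottom sheet `tr(adj S₀·S₁') = η·(kᵀadj(S₀)k) ≠ 0`) yields a chain of `N + 2`
  points — the new bottom monomial `X^{2d₀+d₁}` adds one alternation point near `0` (`altChain_lift_step`);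
* `card_posRoots_of_nullBottom_subStratum` — composing with the tree's null-end lift: a chain of `N + 1` points on the bottom
  sub-stratum gives `≥ N + 2` distinct positive roots after unfolding `S₁` and then `S₀` (with `N = 17`: a sub-stratum
  chain-SEVENTEEN lifts to a NINETEEN); `card_posRoots_of_nullNull_subStratum` — with BOTH ends singular, three unfoldings
  (`S₁`, `S₀`, `S₃`) give `≥ N + 3` (with `N = 16`: a null-null sub-stratum chain-SIXTEEN lifts to a NINETEEN).
The top versions (mirror `t ↦ 1/t`, p575885's own sub-stratum `det S₃ = 0`, `tr(adj S₃·S₂) = 0`) and the door / stub readings are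
the companion file `…CensusDoorA34SubStratumLiftTop`.

READING (for the planners of the strata line; no claim beyond the theorems): the sub-strata closed by monomial count at their own
Descartes bound (`17`, `16`) are, GIVEN the door or the stubs, themselves DEFICIENT BY ONE (`≤ 16`, `≤ 15` in chain currency): the
strata line does not bottom out at any finite depth by monomial counting — each vanishing end coefficient opens the same
deficiency-one question one Descartes step lower, and conversely an alternation-sharp object on ANY such sub-stratum would lift,
end by end, to a nineteen.  Whether deficiency one holds on the sub-strata is exactly as open as the stubs.

NOTHING here asserts that such objects exist or do not exist; nothing bounds `ζ_sym(3,4)` (registers `18 ≤ ζ_sym(3,4) ≤ 19`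
unchanged); `DoorA34` and both stubs stay OPEN; nothing bears on `MatrixDescartes` (stmt-ValiantsHypothesis-18050) or on
`VP ≠ VNP` — VP≠VNP not moved.

[folklore] Matrix determinant lemma; alternation chains and intermediate values near `0`; letter reversal `t ↦ 1/t`.
-/

-- `Summit.ValiantsHypothesis.ValiantsHypothesis.…` repeats a component by the D-0017 layout
-- (single-conjunct summit), which the `dupNamespace` linter flags; the name is mandated.
set_option linter.dupNamespace false

namespace Summit.ValiantsHypothesis.ValiantsHypothesis.Theorems.LacunarySymmetroidMatrixDescartes.Census

open Polynomial Finset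
open scoped BigOperators Polynomial Matrix
open Summit.ValiantsHypothesis.ValiantsHypothesis.Theorems.MatrixDescartes.Negative (PosRootLawAt)

/-! ## Rank-one perturbation of an arbitrary letter -/

/-- **Pencil form of the rank-one determinant lemma, arbitrary letter.**  Perturbing the letter `S l₀` by `η·kkᵀ` changes the
pencil determinant by `η · X^{d l₀} · (kᵀ adj(F) k)` (as polynomials). [folklore] -/
theorem det_pencil_perturb_rankOne_letter (l₀ : Fin 4) (d : Fin 4 → ℕ) (S : Fin 4 → Matrix (Fin 3) (Fin 3) ℝ)
    (k : Fin 3 → ℝ) (η : ℝ) :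
    ((∑ l, (X : ℝ[X]) ^ d l • ((S l + if l = l₀ then η • Matrix.vecMulVec k k else 0)).map C)).det
      = ((∑ l, (X : ℝ[X]) ^ d l • (S l).map C)).det
        + C η * (X ^ d l₀ * ((fun i => C (k i)) ⬝ᵥ ((∑ l, (X : ℝ[X]) ^ d l • (S l).map C).adjugate *ᵥ (fun i => C (k i))))) := by
  have hsplit : (∑ l, (X : ℝ[X]) ^ d l • ((S l + if l = l₀ then η • Matrix.vecMulVec k k else 0)).map C)
      = (∑ l, (X : ℝ[X]) ^ d l • (S l).map C) + (C η * X ^ d l₀) • Matrix.vecMulVec (fun i => C (k i)) (fun i => C (k i)) := by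
    have h : ∀ l : Fin 4, (X : ℝ[X]) ^ d l • ((S l + if l = l₀ then η • Matrix.vecMulVec k k else 0)).map C
        = (X : ℝ[X]) ^ d l • (S l).map C
          + (if l = l₀ then (X : ℝ[X]) ^ d l • ((η • Matrix.vecMulVec k k).map C) else 0) := by
      intro l
      split_ifs
      · rw [Matrix.map_add, smul_add]
        exact fun a b => C_add
      · rw [add_zero, add_zero]
    simp_rw [h, Finset.sum_add_distrib, Finset.sum_ite_eq', Finset.mem_univ, if_true]
    congr 1
    ext i j
    simp only [Matrix.smul_apply, Matrix.map_apply, Matrix.vecMulVec_apply, smul_eq_mul, C_mul]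
    ring_nf
  rw [hsplit, det_add_smul_vecMulVec_fin_three]
  ring

/-- the letters with one letter perturbed by `η·kkᵀ` stay symmetric. [folklore] -/
theorem perturb_rankOne_letter_isSymm (l₀ : Fin 4) (S : Fin 4 → Matrix (Fin 3) (Fin 3) ℝ) (hS : ∀ l, (S l).IsSymm)
    (k : Fin 3 → ℝ) (η : ℝ) (l : Fin 4) : (S l + if l = l₀ then η • Matrix.vecMulVec k k else 0).IsSymm := by
  split_ifs
  · refine (hS l).add (Matrix.IsSymm.smul ?_ η)
    unfold Matrix.IsSymm
    ext i j
    simp [Matrix.vecMulVec_apply, mul_comm]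
  · rw [add_zero]; exact hS l

/-! ## The bottom sub-stratum: the coefficients of order `≤ 2d₀ + d₁` vanish -/

/-- **Low coefficients on the bottom sub-stratum.**  If `det S₀ = 0`, `tr(adj S₀ · S₁) = 0` and `d 0 < d 1 < d l` (`l ∉ {0,1}`),
then every coefficient of the pencil determinant of order `≤ 2 d₀ + d₁` vanishes: the monomials `X^{3d₀}` (coefficient `det S₀`) and
`X^{2d₀+d₁}` (coefficient `tr(adj S₀·S₁)`) are the only candidates there (block anatomy read at the bottom letter). [folklore] -/
theorem coeff_det_pencil_eq_zero_of_nullBottom_subStratum (d : Fin 4 → ℕ) (S : Fin 4 → Matrix (Fin 3) (Fin 3) ℝ)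
    (hdet : (S 0).det = 0) (htr : ((S 0).adjugate * S 1).trace = 0)
    (h01 : d 0 < d 1) (h1 : ∀ l, l ≠ 0 → l ≠ 1 → d 1 < d l) (n : ℕ) (hn : n ≤ 2 * d 0 + d 1) :
    ((∑ l, (X : ℝ[X]) ^ d l • (S l).map C).det).coeff n = 0 := by
  classical
  -- re-index the letters by `Fin.rev`: the bottom letter becomes the top letter of the re-indexed family
  set d' : Fin 4 → ℕ := fun l => d (Fin.rev l) with hd'
  set S' : Fin 4 → Matrix (Fin 3) (Fin 3) ℝ := fun l => S (Fin.rev l) with hS'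
  have hrev3 : Fin.rev (3 : Fin 4) = 0 := by decide
  have hpencil : (∑ l, (X : ℝ[X]) ^ d l • (S l).map C) = ∑ l, (X : ℝ[X]) ^ d' l • (S' l).map C := by
    simp only [hd', hS']
    exact (pencil_comp_rev d S).symm
  have hdet' : (S' 3).det = 0 := by simp only [hS', hrev3]; exact hdet
  have hS'3 : S' 3 = S 0 := by simp only [hS', hrev3]
  have hd'3 : d' 3 = d 0 := by simp only [hd', hrev3]
  -- exponents of the three core letters (`S 3, S 2, S 1`) are all `≥ d 1`
  have hcore : ∀ l : Fin 3, d 1 ≤ d' (Fin.castSucc l) := by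
    intro l
    fin_cases l
    · have h : Fin.rev (Fin.castSucc (0 : Fin 3)) = (3 : Fin 4) := by decide
      show d 1 ≤ d (Fin.rev (Fin.castSucc (0 : Fin 3)))
      rw [h]; exact (h1 3 (by decide) (by decide)).le
    · have h : Fin.rev (Fin.castSucc (1 : Fin 3)) = (2 : Fin 4) := by decide
      show d 1 ≤ d (Fin.rev (Fin.castSucc (1 : Fin 3)))
      rw [h]; exact (h1 2 (by decide) (by decide)).le
    · have h : Fin.rev (Fin.castSucc (2 : Fin 3)) = (1 : Fin 4) := by decide
      show d 1 ≤ d (Fin.rev (Fin.castSucc (2 : Fin 3)))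
      rw [h]
  have hcore_strict : ∀ l : Fin 3, l ≠ 2 → d 1 < d' (Fin.castSucc l) := by
    intro l hl
    fin_cases l
    · have h : Fin.rev (Fin.castSucc (0 : Fin 3)) = (3 : Fin 4) := by decide
      show d 1 < d (Fin.rev (Fin.castSucc (0 : Fin 3)))
      rw [h]; exact h1 3 (by decide) (by decide)
    · have h : Fin.rev (Fin.castSucc (1 : Fin 3)) = (2 : Fin 4) := by decide
      show d 1 < d (Fin.rev (Fin.castSucc (1 : Fin 3)))
      rw [h]; exact h1 2 (by decide) (by decide)
    · exact absurd rfl hl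
  rw [hpencil, det_pencil_nullTop_eq_blocks d' S' hdet', Polynomial.coeff_add, Polynomial.coeff_add]
  set G : Matrix (Fin 3) (Fin 3) ℝ[X] :=
    ∑ l : Fin 3, (X : ℝ[X]) ^ d' (Fin.castSucc l) • (S' (Fin.castSucc l)).map C with hG
  -- block 1: `det G` is supported on triple sums of core exponents, all `≥ 3 d 1 > n`
  have hB1 : G.det.coeff n = 0 := by
    by_contra h
    have hmem := StubDescartesCeiling.support_det_pencil_subset (fun l : Fin 3 => d' (Fin.castSucc l))
      (fun l => S' (Fin.castSucc l)) (Polynomial.mem_support_iff.mpr h)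
    obtain ⟨s, -, hs⟩ := Finset.mem_image.mp hmem
    have hcard : Multiset.card (((s : Multiset (Fin 3)).map (fun l : Fin 3 => d' (Fin.castSucc l)))) = 3 := by
      rw [Multiset.card_map]; exact Sym.card_coe
    have hle : Multiset.card (((s : Multiset (Fin 3)).map (fun l : Fin 3 => d' (Fin.castSucc l)))) • d 1
        ≤ ((s : Multiset (Fin 3)).map (fun l : Fin 3 => d' (Fin.castSucc l))).sum := by
      refine Multiset.card_nsmul_le_sum ?_
      intro x hx
      obtain ⟨l, -, rfl⟩ := Multiset.mem_map.mp hx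
      exact hcore l
    rw [hcard, hs, smul_eq_mul] at hle
    omega
  -- block 2: `X^{d 0} · tr(adj G · S₀)`: the adjugate entries are supported on pair sums `≥ 2 d 1 > n - d 0`
  have hB2 : ((X : ℝ[X]) ^ d' 3 * (G.adjugate * (S' 3).map C).trace).coeff n = 0 := by
    rw [Polynomial.coeff_X_pow_mul']
    split_ifs with hle
    · simp only [Matrix.trace, Matrix.diag, Matrix.mul_apply, Matrix.map_apply, Polynomial.finsetSum_coeff,
        Polynomial.coeff_mul_C]
      refine Finset.sum_eq_zero fun i _ => Finset.sum_eq_zero fun j _ => ?_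
      have h0 : (G.adjugate i j).coeff (n - d' 3) = 0 := by
        refine Polynomial.notMem_support_iff.mp fun h => ?_
        have hmem := support_adjugate_pencil_apply_subset' (fun l : Fin 3 => d' (Fin.castSucc l))
          (fun l => S' (Fin.castSucc l)) i j h
        obtain ⟨f, -, hf⟩ := Finset.mem_image.mp hmem
        have h2 : 2 * d 1 ≤ ∑ i, d' (Fin.castSucc (f i)) := by
          have := Finset.sum_le_sum (s := (Finset.univ : Finset (Fin 2))) fun i _ => hcore (f i)
          simpa using this
        rw [hd'3] at hf
        omega
      rw [h0, zero_mul]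
    · rfl
  -- block 3: `X^{2 d 0} · tr(adj S₀ · G) = Σ_l X^{2d₀ + e_l} · tr(adj S₀ · S_l)`: only `X^{2d₀+d₁}` is low enough, and its
  -- coefficient is `tr(adj S₀ · S₁) = 0`
  have hB3 : (((X : ℝ[X]) ^ d' 3) ^ 2 * (((S' 3).map C).adjugate * G).trace).coeff n = 0 := by
    rw [hG, trace_adjugate_map_mul_corePencil d' S', ← pow_mul, Polynomial.coeff_X_pow_mul']
    split_ifs with hle
    · rw [Polynomial.finsetSum_coeff]
      refine Finset.sum_eq_zero fun l _ => ?_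
      rw [Polynomial.coeff_X_pow_mul']
      split_ifs with hle'
      · rw [Polynomial.coeff_C]
        split_ifs with heq
        · -- the exponent is exactly `d 1`, i.e. the letter is `S 1`
          by_cases hl2 : l = 2
          · subst hl2
            have h : Fin.rev (Fin.castSucc (2 : Fin 3)) = (1 : Fin 4) := by decide
            show ((S' 3).adjugate * S' (Fin.castSucc (2 : Fin 3))).trace = 0
            rw [hS'3]
            show ((S 0).adjugate * S (Fin.rev (Fin.castSucc (2 : Fin 3)))).trace = 0
            rw [h]; exact htr
          · exfalso
            have := hcore_strict l hl2
            rw [hd'3] at hle'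
            omega
        · rfl
      · rfl
    · rfl
  rw [hB1, hB2, hB3, add_zero, add_zero]

/-! ## The sub-stratum lift (bottom end, chain currency) -/

/-- **SUB-STRATUM LIFT (bottom end, chain currency).**  Let `d 0 < d 1 < d l` (`l ∉ {0,1}`), `det S₀ = 0`, `tr(adj S₀ · S₁) = 0`
(the bottom sub-stratum), `kᵀ adj(S₀) k ≠ 0`, and let the pencil determinant carry an alternation chain of `N + 1` positive points.
Then for some real `η` the pencil with `S₁ ↦ S₁ + η·kkᵀ` (same support; `S₀` untouched, so still `det S₀ = 0`, and now
`tr(adj S₀·S₁') = η · kᵀadj(S₀)k ≠ 0`: the GENERIC null-bottom sheet) carries an alternation chain of `N + 2` positive points.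
[folklore] -/
theorem exists_altChain_of_nullBottom_subStratum (d : Fin 4 → ℕ) (h01 : d 0 < d 1) (h1 : ∀ l, l ≠ 0 → l ≠ 1 → d 1 < d l)
    (S : Fin 4 → Matrix (Fin 3) (Fin 3) ℝ) (hdet : (S 0).det = 0) (htr : ((S 0).adjugate * S 1).trace = 0)
    (k : Fin 3 → ℝ) (hk : k ⬝ᵥ ((S 0).adjugate *ᵥ k) ≠ 0)
    {N : ℕ} {s : ℝ} {a : Fin (N + 1) → ℝ}
    (hchain : AltChain ((∑ l, (X : ℝ[X]) ^ d l • (S l).map C).det) N s a) :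
    ∃ η s' : ℝ, ∃ a' : Fin (N + 2) → ℝ, AltChain ((∑ l, (X : ℝ[X]) ^ d l •
      ((S l + if l = 1 then η • Matrix.vecMulVec k k else 0)).map C).det) (N + 1) s' a' := by
  classical
  have h0 : ∀ l, l ≠ 0 → d 0 < d l := by
    intro l hl
    by_cases hl1 : l = 1
    · rw [hl1]; exact h01
    · exact h01.trans (h1 l hl hl1)
  have h0' : ∀ l, d 0 ≤ d l := fun l => by
    by_cases hl : l = 0
    · rw [hl]
    · exact (h0 l hl).le
  set P : Matrix (Fin 3) (Fin 3) ℝ[X] := ∑ l, (X : ℝ[X]) ^ d l • (S l).map C with hP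
  set Nm : Matrix (Fin 3) (Fin 3) ℝ[X] := ∑ l, (X : ℝ[X]) ^ (d l - d 0) • (S l).map C with hNm
  have hPN : P = (X : ℝ[X]) ^ d 0 • Nm := pencil_eq_X_pow_smul d S h0'
  set kC : Fin 3 → ℝ[X] := fun i => C (k i) with hkC
  set q₁ : ℝ[X] := kC ⬝ᵥ (Nm.adjugate *ᵥ kC) with hq₁
  set g : ℝ[X] := P.det with hg
  set r : ℝ[X] := X ^ d 1 * (kC ⬝ᵥ (P.adjugate *ᵥ kC)) with hr
  -- `r = X^{d₁ + 2 d₀} · q₁`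
  have hr' : r = X ^ (2 * d 0 + d 1) * q₁ := by
    rw [hr, hPN, Matrix.adjugate_smul, Fintype.card_fin]
    show X ^ d 1 * (kC ⬝ᵥ ((((X : ℝ[X]) ^ d 0) ^ (3 - 1) • Nm.adjugate) *ᵥ kC)) = X ^ (2 * d 0 + d 1) * q₁
    rw [Matrix.smul_mulVec, dotProduct_smul, smul_eq_mul, hq₁, ← mul_assoc, ← pow_mul, ← pow_add]
    congr 2
    omega
  -- value at `0`: `q₁(0) = kᵀ adj(S₀) k`
  have hN0 : (Polynomial.evalRingHom 0).mapMatrix Nm = S 0 := eval_zero_reduced_pencil d S h0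
  have hq0 : q₁.coeff 0 = k ⬝ᵥ ((S 0).adjugate *ᵥ k) := by
    set φ : ℝ[X] →+* ℝ := Polynomial.evalRingHom 0 with hφ
    have hk' : (⇑φ ∘ kC) = k := by funext i; simp [hφ, hkC]
    have hmv : (⇑φ ∘ (Nm.adjugate *ᵥ kC)) = (φ.mapMatrix Nm).adjugate *ᵥ k := by
      funext i
      rw [Function.comp_apply, RingHom.map_mulVec, hk', ← RingHom.map_adjugate]
      rfl
    rw [Polynomial.coeff_zero_eq_eval_zero, ← Polynomial.coe_evalRingHom, ← hφ, hq₁, RingHom.map_dotProduct, hmv, hk',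
      hN0]
  -- coefficient hypotheses of the lifting step at order `e = 2 d₀ + d₁`
  have hgcoeff : ∀ n ≤ 2 * d 0 + d 1, g.coeff n = 0 := fun n hn =>
    coeff_det_pencil_eq_zero_of_nullBottom_subStratum d S hdet htr h01 h1 n hn
  have hrcoeff : ∀ n < 2 * d 0 + d 1, r.coeff n = 0 := by
    intro n hn
    rw [hr', Polynomial.coeff_X_pow_mul', if_neg (not_le.mpr hn)]
  have hre : r.coeff (2 * d 0 + d 1) ≠ 0 := by
    rw [hr', Polynomial.coeff_X_pow_mul', if_pos le_rfl, Nat.sub_self, hq0]; exact hk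
  -- the lifting step
  have hs : s ≠ 0 := by
    intro h; have := hchain.2.2.2; rw [h, zero_mul] at this; exact lt_irrefl _ this
  obtain ⟨η₀, hη₀, H⟩ := altChain_lift_step g r (2 * d 0 + d 1) hgcoeff hrcoeff hre N s a hchain
  obtain ⟨η, hη, hηb, hηs⟩ := exists_small_of_sign η₀ s (r.coeff (2 * d 0 + d 1)) hη₀ hs hre
  obtain ⟨a', -, -, hchain'⟩ := H η hη hηb hηs
  have hid : ((∑ l, (X : ℝ[X]) ^ d l • ((S l + if l = 1 then η • Matrix.vecMulVec k k else 0)).map C)).det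
      = g + C η * r := by
    rw [det_pencil_perturb_rankOne_letter 1, hg, hr]
  refine ⟨η, η * r.coeff (2 * d 0 + d 1), a', ?_⟩
  rw [hid]
  exact hchain'

/-- **Sub-stratum lift composed with the null-end lift (bottom end, count currency).**  Under the hypotheses of
`exists_altChain_of_nullBottom_subStratum`, for some reals `η₁, η₀` the pencil with `S₁ ↦ S₁ + η₁·kkᵀ` and then `S₀ ↦ S₀ + η₀·kkᵀ`
(same support) has at least `N + 2` distinct positive determinant roots.  With `N = 17`: a bottom SUB-STRATUM chain-SEVENTEEN lifts
to a NINETEEN. [folklore] -/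
theorem card_posRoots_of_nullBottom_subStratum (d : Fin 4 → ℕ) (h01 : d 0 < d 1) (h1 : ∀ l, l ≠ 0 → l ≠ 1 → d 1 < d l)
    (S : Fin 4 → Matrix (Fin 3) (Fin 3) ℝ) (hdet : (S 0).det = 0) (htr : ((S 0).adjugate * S 1).trace = 0)
    (k : Fin 3 → ℝ) (hk : k ⬝ᵥ ((S 0).adjugate *ᵥ k) ≠ 0)
    {N : ℕ} {s : ℝ} {a : Fin (N + 1) → ℝ}
    (hchain : AltChain ((∑ l, (X : ℝ[X]) ^ d l • (S l).map C).det) N s a) :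
    ∃ η₁ η₀ : ℝ, N + 2 ≤ ((((∑ l, (X : ℝ[X]) ^ d l •
      (((S l + if l = 1 then η₁ • Matrix.vecMulVec k k else 0) + if l = 0 then η₀ • Matrix.vecMulVec k k else 0)).map C)).det
        ).roots.toFinset.filter (fun t => 0 < t)).card := by
  have h0 : ∀ l, l ≠ 0 → d 0 < d l := by
    intro l hl
    by_cases hl1 : l = 1
    · rw [hl1]; exact h01
    · exact h01.trans (h1 l hl hl1)
  obtain ⟨η₁, s', a', hchain'⟩ := exists_altChain_of_nullBottom_subStratum d h01 h1 S hdet htr k hk hchain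
  set S₁ : Fin 4 → Matrix (Fin 3) (Fin 3) ℝ := fun l => S l + if l = 1 then η₁ • Matrix.vecMulVec k k else 0 with hS₁
  have h10 : S₁ 0 = S 0 := by simp [hS₁]
  have hdet' : (S₁ 0).det = 0 := by rw [h10]; exact hdet
  have hk' : k ⬝ᵥ ((S₁ 0).adjugate *ᵥ k) ≠ 0 := by rw [h10]; exact hk
  obtain ⟨η₀, h⟩ := nineteen_of_nullBottom_eighteen d h0 S₁ hdet' k hk' hchain'
  exact ⟨η₁, η₀, h⟩

/-! ## Both ends singular: the null-null sub-stratum lifts in three steps -/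

/-- **NULL-NULL SUB-STRATUM LIFT.**  Let `d 0 < d 1 < d l < d 3`… precisely `d 0 < d 1`, `d 1 < d l` (`l ∉ {0,1}`) and `d l < d 3`
(`l ≠ 3`); let BOTH end letters be singular of adjugate rank (`kᵢᵀ adj(Sᵢ) kᵢ ≠ 0`), the bottom one on its sub-stratum
`tr(adj S₀ · S₁) = 0`, and let the determinant carry an alternation chain of `N + 1` positive points.  Then three rank-one unfoldings
(`S₁`, then `S₀`, then `S₃`; same support) give at least `N + 3` distinct positive roots.  With `N = 16`: a NULL-NULL SUB-STRATUM
chain-SIXTEEN lifts to a NINETEEN (the top-sub-stratum version is this statement on the mirror support). [folklore] -/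
theorem card_posRoots_of_nullNull_subStratum (d : Fin 4 → ℕ) (h01 : d 0 < d 1) (h1 : ∀ l, l ≠ 0 → l ≠ 1 → d 1 < d l)
    (h3 : ∀ l, l ≠ 3 → d l < d 3)
    (S : Fin 4 → Matrix (Fin 3) (Fin 3) ℝ) (hdet0 : (S 0).det = 0) (htr : ((S 0).adjugate * S 1).trace = 0)
    (hdet3 : (S 3).det = 0)
    (k₀ : Fin 3 → ℝ) (hk₀ : k₀ ⬝ᵥ ((S 0).adjugate *ᵥ k₀) ≠ 0)
    (k₃ : Fin 3 → ℝ) (hk₃ : k₃ ⬝ᵥ ((S 3).adjugate *ᵥ k₃) ≠ 0)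
    {N : ℕ} {s : ℝ} {a : Fin (N + 1) → ℝ}
    (hchain : AltChain ((∑ l, (X : ℝ[X]) ^ d l • (S l).map C).det) N s a) :
    ∃ η₁ η₀ η₃ : ℝ, N + 3 ≤ ((((∑ l, (X : ℝ[X]) ^ d l •
      ((((S l + if l = 1 then η₁ • Matrix.vecMulVec k₀ k₀ else 0) + if l = 0 then η₀ • Matrix.vecMulVec k₀ k₀ else 0)
        + if l = 3 then η₃ • Matrix.vecMulVec k₃ k₃ else 0)).map C)).det).roots.toFinset.filter (fun t => 0 < t)).card := by
  have h0 : ∀ l, l ≠ 0 → d 0 < d l := by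
    intro l hl
    by_cases hl1 : l = 1
    · rw [hl1]; exact h01
    · exact h01.trans (h1 l hl hl1)
  -- step 1: the sub-stratum lift (chain `N + 2`)
  obtain ⟨η₁, s', a', hchain'⟩ := exists_altChain_of_nullBottom_subStratum d h01 h1 S hdet0 htr k₀ hk₀ hchain
  set S₁ : Fin 4 → Matrix (Fin 3) (Fin 3) ℝ := fun l => S l + if l = 1 then η₁ • Matrix.vecMulVec k₀ k₀ else 0 with hS₁
  have h10 : S₁ 0 = S 0 := by simp [hS₁]
  have h13 : S₁ 3 = S 3 := by simp [hS₁]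
  -- step 2: the null-bottom lift (chain `N + 3`)
  obtain ⟨η₀, s'', a'', hchain''⟩ :=
    exists_altChain_of_nullBottom d h0 S₁ (by rw [h10]; exact hdet0) k₀ (by rw [h10]; exact hk₀) hchain'
  set S₂ : Fin 4 → Matrix (Fin 3) (Fin 3) ℝ := fun l => S₁ l + if l = 0 then η₀ • Matrix.vecMulVec k₀ k₀ else 0 with hS₂
  have h23 : S₂ 3 = S 3 := by simp [hS₂, hS₁]
  -- step 3: the null-top lift (count `N + 3`)
  obtain ⟨η₃, h⟩ :=
    nineteen_of_nullTop_eighteen d h3 S₂ (by rw [h23]; exact hdet3) k₃ (by rw [h23]; exact hk₃) hchain''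
  exact ⟨η₁, η₀, η₃, h⟩

end Summit.ValiantsHypothesis.ValiantsHypothesis.Theorems.LacunarySymmetroidMatrixDescartes.Census
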